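import Literature.Analysis.FluidPDE.ElgindiSupBounds
import HarnessLib

/-!
# The first product rule in `𝓗⁴` (Elgindi–Ghoul–Masmoudi, Proposition 9.2) for test functions
([ElgindiGhoulMasmoudi2021] §9 Proposition 9.2)

Topic `Literature/Analysis/FluidPDE`. Proof file (everything proved, no definitions, no named
facts) on the proof path of the named fact
`Literature.Analysis.FluidPDE.Elgindi.ElgindiGhoulMasmoudi2021_stabilityCore`
(`ElgindiStabilityDecomposition.lean`). Elgindi–Ghoul–Masmoudi, arXiv:1910.14071, §9
Proposition 9.2 (p. 20), case `k = 4`: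

> "Let `k ≥ 4` and assume `f, g ∈ 𝓗ᵏ`. Then `fg ∈ 𝓗ᵏ` and `|fg|_{𝓗ᵏ} ≤ (C/√(γ−1))|f|_{𝓗ᵏ}|g|_{𝓗ᵏ}`."

Here for test functions of the strip (smooth, compactly supported inside the open strip), in the
squared form `|fg|²_{𝓗⁴} ≤ (K/(γ−1))|f|²_{𝓗⁴}|g|²_{𝓗⁴}` with a universal `K` (`eHkNormSq_mul_le`).
Every Leibniz term `(D^af)(D^bg)` has `min(|a|,|b|) ≤ 2`; the factor with few derivatives is put in
`L^∞` by `ElgindiSupBounds.lean` unless this produces a pure radial derivative against the angular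
weight `sin(2θ)^{−γ}`, which happens exactly for the awkward terms `(D_θf)(D_z³g)`, `(D_z³f)(D_θg)`,
handled by the separated bound.
-/

noncomputable section

open MeasureTheory Set Function Real Filter Finset
open _root_.Topology
open scoped ENNReal

namespace Literature.Analysis.FluidPDE

namespace Elgindi

/-! ### The term bound -/

section termBound

variable {α : ℝ} (hα : 0 < α) (hα10 : α ≤ 10) {u v : ℝ → ℝ → ℝ} (hu : StripTest u) (hv : StripTest v)
include hα hα10 hu hv

omit hu hv in
/-- The weighted integral of a word of `v` against `s^{−c}`, `c ∈ {η, γ}`: `≤ |v|²_{𝓗⁴}` when the word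
has an angular derivative (`b₁ ≥ 1`) or `c = η`. [folklore] -/
theorem lintegral_word_le {b₁ b₂ : ℕ} (hb : b₁ + b₂ ≤ 4) {c : ℝ} (hc : c = eta ∨ c = gammaExp α) (hgood : c = gammaExp α → 1 ≤ b₁) :
    ∫⁻ p in strip, ENNReal.ofReal (radialWeight p.1 ^ 2 * ((Dθ^[b₁] (Dz^[b₂] v)) p.1 p.2) ^ 2 * Real.sin (2 * p.2) ^ (-c)) ≤ eHkNormSq α 4 v := by
  have hγ : gammaExp α ≤ 2 := by unfold gammaExp; linarith
  have hηγ : eta ≤ gammaExp α := by unfold eta gammaExp; linarith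
  rcases Nat.eq_zero_or_pos b₁ with h0 | hpos
  · -- `b₁ = 0` forces `c = η`: a radial term
    subst h0
    have hcη : c = eta := by
      rcases hc with h | h
      · exact h
      · exact absurd (hgood h) (by omega)
    subst hcη
    calc ∫⁻ p in strip, ENNReal.ofReal (radialWeight p.1 ^ 2 * ((Dθ^[0] (Dz^[b₂] v)) p.1 p.2) ^ 2 * Real.sin (2 * p.2) ^ (-eta))
        = eL2Sq (hkRadialTerm b₂ v) := by
          rw [eL2Sq_eq_lintegral_ofReal]
          refine setLIntegral_congr_fun measurableSet_strip fun p hp => ?_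
          rw [sq_hkRadialTerm b₂ v hp]; rfl
      _ ≤ eHkNormSq α 4 v := eL2Sq_hkRadialTerm_le α (by omega) v
  · -- `b₁ ≥ 1`: a mixed term, `s^{-c} ≤ s^{-γ}`
    calc ∫⁻ p in strip, ENNReal.ofReal (radialWeight p.1 ^ 2 * ((Dθ^[b₁] (Dz^[b₂] v)) p.1 p.2) ^ 2 * Real.sin (2 * p.2) ^ (-c))
        ≤ ∫⁻ p in strip, ENNReal.ofReal (radialWeight p.1 ^ 2 * ((Dθ^[b₁] (Dz^[b₂] v)) p.1 p.2) ^ 2 * Real.sin (2 * p.2) ^ (-gammaExp α)) := by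
          refine setLIntegral_mono' measurableSet_strip fun p hp => ENNReal.ofReal_le_ofReal ?_
          have hs : 0 < Real.sin (2 * p.2) := Real.sin_pos_of_pos_of_lt_pi (by linarith [hp.2.1]) (by linarith [hp.2.2])
          have hs1 : Real.sin (2 * p.2) ≤ 1 := Real.sin_le_one _
          have hle : Real.sin (2 * p.2) ^ (-c) ≤ Real.sin (2 * p.2) ^ (-gammaExp α) := by
            refine Real.rpow_le_rpow_of_exponent_ge hs hs1 ?_
            rcases hc with h | h
            · rw [h]; linarith
            · rw [h]
          exact mul_le_mul_of_nonneg_left hle (by positivity)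
      _ = eL2Sq (hkMixedTerm α b₁ b₂ v) := by
          rw [eL2Sq_eq_lintegral_ofReal]
          refine setLIntegral_congr_fun measurableSet_strip fun p hp => ?_
          rw [sq_hkMixedTerm α b₁ b₂ v hp]
      _ ≤ eHkNormSq α 4 v := eL2Sq_hkMixedTerm_le α hpos hb v

omit hv in
/-- **The `L^∞ × L²` bound** (sup on the first factor). [folklore] -/
theorem lintegral_term_supLeft {a₁ a₂ b₁ b₂ : ℕ} (ha : a₁ + a₂ ≤ 2) (hb : b₁ + b₂ ≤ 4) {c : ℝ} (hc : c = eta ∨ c = gammaExp α)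
    (hgood : c = gammaExp α → 1 ≤ b₁) {v : ℝ → ℝ → ℝ} (hv : StripTest v) :
    ∫⁻ p in strip, ENNReal.ofReal (radialWeight p.1 ^ 2 * (((Dθ^[a₁] (Dz^[a₂] u)) p.1 p.2) * ((Dθ^[b₁] (Dz^[b₂] v)) p.1 p.2)) ^ 2 * Real.sin (2 * p.2) ^ (-c)) ≤
      ENNReal.ofReal (π / (3 * (gammaExp α - 1))) * (eHkNormSq α 4 u * eHkNormSq α 4 v) := by
  have hX : ∀ p : ℝ × ℝ, ENNReal.ofReal (((Dθ^[a₁] (Dz^[a₂] u)) p.1 p.2) ^ 2) ≤ ENNReal.ofReal (π / (3 * (gammaExp α - 1))) * eHkNormSq α 4 u :=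
    fun p => sq_word_le_eHkNormSq hα hα10 hu ha p.1 p.2
  have hY := lintegral_word_le hα hα10 hb hc hgood (v := v)
  calc ∫⁻ p in strip, ENNReal.ofReal (radialWeight p.1 ^ 2 * (((Dθ^[a₁] (Dz^[a₂] u)) p.1 p.2) * ((Dθ^[b₁] (Dz^[b₂] v)) p.1 p.2)) ^ 2 * Real.sin (2 * p.2) ^ (-c))
      ≤ ∫⁻ p in strip, (ENNReal.ofReal (π / (3 * (gammaExp α - 1))) * eHkNormSq α 4 u) *
          ENNReal.ofReal (radialWeight p.1 ^ 2 * ((Dθ^[b₁] (Dz^[b₂] v)) p.1 p.2) ^ 2 * Real.sin (2 * p.2) ^ (-c)) := by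
        refine setLIntegral_mono' measurableSet_strip fun p hp => ?_
        have hs : 0 ≤ Real.sin (2 * p.2) ^ (-c) := Real.rpow_nonneg (Real.sin_pos_of_pos_of_lt_pi (by linarith [hp.2.1]) (by linarith [hp.2.2])).le _
        have e : radialWeight p.1 ^ 2 * (((Dθ^[a₁] (Dz^[a₂] u)) p.1 p.2) * ((Dθ^[b₁] (Dz^[b₂] v)) p.1 p.2)) ^ 2 * Real.sin (2 * p.2) ^ (-c) =
            ((Dθ^[a₁] (Dz^[a₂] u)) p.1 p.2) ^ 2 * (radialWeight p.1 ^ 2 * ((Dθ^[b₁] (Dz^[b₂] v)) p.1 p.2) ^ 2 * Real.sin (2 * p.2) ^ (-c)) := by ring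
        rw [e, ENNReal.ofReal_mul (sq_nonneg _)]
        exact mul_le_mul_left (hX p) _
    _ = (ENNReal.ofReal (π / (3 * (gammaExp α - 1))) * eHkNormSq α 4 u) *
          ∫⁻ p in strip, ENNReal.ofReal (radialWeight p.1 ^ 2 * ((Dθ^[b₁] (Dz^[b₂] v)) p.1 p.2) ^ 2 * Real.sin (2 * p.2) ^ (-c)) := by
        rw [lintegral_const_mul'' _ ?_]
        have c1 : Measurable fun q : ℝ × ℝ => (Dθ^[b₁] (Dz^[b₂] v)) q.1 q.2 := ((hv.smooth.ofWord b₁ b₂) 0).continuous.measurable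
        have c2 : Measurable fun q : ℝ × ℝ => radialWeight q.1 := by unfold radialWeight; fun_prop
        have c3 : Measurable fun q : ℝ × ℝ => Real.sin (2 * q.2) ^ (-c) := by fun_prop
        exact (((c2.pow_const 2).mul (c1.pow_const 2)).mul c3).ennreal_ofReal.aemeasurable
    _ ≤ (ENNReal.ofReal (π / (3 * (gammaExp α - 1))) * eHkNormSq α 4 u) * eHkNormSq α 4 v := mul_le_mul_right hY _
    _ = _ := by ring

/-- **The term bound**: for `|a| + |b| ≤ 4`, `c ∈ {η,γ}` with `c = γ → a₁ + b₁ ≥ 1`,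
`∫∫ w²(D^au·D^bv)²s^{−c} ≤ (π/(3(γ−1)))|u|²_{𝓗⁴}|v|²_{𝓗⁴}`. [cite: ElgindiGhoulMasmoudi2021, §9 proof of Proposition 9.2 (p. 20 of arXiv:1910.14071)] -/
theorem lintegral_term_le {a₁ a₂ b₁ b₂ : ℕ} (hab : a₁ + a₂ + (b₁ + b₂) ≤ 4) {c : ℝ} (hc : c = eta ∨ c = gammaExp α)
    (hgood : c = gammaExp α → 1 ≤ a₁ + b₁) :
    ∫⁻ p in strip, ENNReal.ofReal (radialWeight p.1 ^ 2 * (((Dθ^[a₁] (Dz^[a₂] u)) p.1 p.2) * ((Dθ^[b₁] (Dz^[b₂] v)) p.1 p.2)) ^ 2 * Real.sin (2 * p.2) ^ (-c)) ≤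
      ENNReal.ofReal (π / (3 * (gammaExp α - 1))) * (eHkNormSq α 4 u * eHkNormSq α 4 v) := by
  -- sup on the left factor
  by_cases hL : a₁ + a₂ ≤ 2 ∧ (c = gammaExp α → 1 ≤ b₁)
  · exact lintegral_term_supLeft hα hα10 hu hL.1 (by omega) hc hL.2 hv
  -- sup on the right factor (symmetric)
  by_cases hR : b₁ + b₂ ≤ 2 ∧ (c = gammaExp α → 1 ≤ a₁)
  · have h := lintegral_term_supLeft hα hα10 hv hR.1 (show a₁ + a₂ ≤ 4 by omega) hc hR.2 hu
    rw [mul_comm (eHkNormSq α 4 v)] at h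
    refine (le_of_eq ?_).trans h
    refine setLIntegral_congr_fun measurableSet_strip fun p _ => ?_
    congr 1; ring
  -- the awkward terms
  have hcγ : c = gammaExp α := by
    rcases hc with h | h
    · exfalso
      have hne : c ≠ gammaExp α := by rw [h]; unfold eta gammaExp; intro h'; linarith
      simp only [hne, IsEmpty.forall_iff, and_true, not_le] at hL hR
      omega
    · exact h
  simp only [hcγ, forall_const] at hL hR hgood
  simp only [not_and, not_le] at hL hR
  -- case analysis: either `a = (1,0), b = (0,3)` or `a = (0,3), b = (1,0)`
  have hcase : (a₁ = 1 ∧ a₂ = 0 ∧ b₁ = 0 ∧ b₂ = 3) ∨ (a₁ = 0 ∧ a₂ = 3 ∧ b₁ = 1 ∧ b₂ = 0) := by omega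
  rcases hcase with ⟨rfl, rfl, rfl, rfl⟩ | ⟨rfl, rfl, rfl, rfl⟩
  · rw [hcγ]
    refine (le_of_eq ?_).trans (lintegral_awkward_le hα hα10 hu hv)
    refine setLIntegral_congr_fun measurableSet_strip fun p _ => ?_
    simp only [Function.iterate_one, Function.iterate_zero, id_eq]; congr 1; ring
  · rw [hcγ, mul_comm (eHkNormSq α 4 u)]
    refine (le_of_eq ?_).trans (lintegral_awkward_le hα hα10 hv hu)
    refine setLIntegral_congr_fun measurableSet_strip fun p _ => ?_
    simp only [Function.iterate_one, Function.iterate_zero, id_eq]; congr 1; ring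

end termBound

/-! ### The product rule -/

/-- **Proposition 9.2 at `k = 4` for test functions**: `|uv|²_{𝓗⁴} ≤ (K/(γ−1))|u|²_{𝓗⁴}|v|²_{𝓗⁴}`,
`K` universal (`0 < α ≤ 10`, `γ = 1 + α/10`). [cite: ElgindiGhoulMasmoudi2021, §9 Proposition 9.2 (p. 20 of arXiv:1910.14071)] -/
theorem eHkNormSq_mul_le {α : ℝ} (hα : 0 < α) (hα10 : α ≤ 10) {u v : ℝ → ℝ → ℝ} (hu : StripTest u) (hv : StripTest v) :
    eHkNormSq α 4 (u * v) ≤ ENNReal.ofReal (30 * (25 * 65536 * 25) * (π / (3 * (gammaExp α - 1)))) * (eHkNormSq α 4 u * eHkNormSq α 4 v) := by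
  set c₀ : ℝ≥0∞ := ENNReal.ofReal (π / (3 * (gammaExp α - 1))) with hc₀
  set EE := eHkNormSq α 4 u * eHkNormSq α 4 v
  have hγpos : 0 < gammaExp α - 1 := by unfold gammaExp; linarith
  -- each term of the functional
  have hterm : ∀ i j, i + j ≤ 4 → (i = 0 ∨ 1 ≤ i) →
      eL2Sq (fun z θ => Dθ^[i] (Dz^[j] (u * v)) z θ * (if i = 0 then hWeight z θ else totalWeight α z θ)) ≤ ENNReal.ofReal (25 * 65536 * 25) * (c₀ * EE) := by
    intro i j hij _
    -- the weight exponent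
    set c : ℝ := if i = 0 then eta else gammaExp α with hcdef
    have hc : c = eta ∨ c = gammaExp α := by by_cases h : i = 0 <;> simp [hcdef, h]
    have hgood : ∀ l, c = gammaExp α → 1 ≤ l + (i - l) ∨ i < l := by
      intro l h
      by_cases hi : i = 0
      · exfalso; simp only [hcdef, hi, ↓reduceIte] at h; unfold eta gammaExp at h; linarith
      · left; omega
    -- index set and the family
    set S : Finset (ℕ × ℕ) := range (j + 1) ×ˢ range (i + 1) with hS
    set G : ℕ × ℕ → ℝ → ℝ → ℝ := fun kl z θ =>
      ((Dθ^[kl.2] (Dz^[kl.1] u)) z θ * (Dθ^[i - kl.2] (Dz^[j - kl.1] v)) z θ) * (if i = 0 then hWeight z θ else totalWeight α z θ) with hG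
    have hGm : ∀ kl ∈ S, AEMeasurable (uncurry (G kl)) (volume.restrict strip) := by
      intro kl _
      have c1 : Continuous fun q : ℝ × ℝ => (Dθ^[kl.2] (Dz^[kl.1] u)) q.1 q.2 := ((hu.smooth.ofWord kl.2 kl.1) 0).continuous
      have c2 : Continuous fun q : ℝ × ℝ => (Dθ^[i - kl.2] (Dz^[j - kl.1] v)) q.1 q.2 := ((hv.smooth.ofWord (i - kl.2) (j - kl.1)) 0).continuous
      have c3 : ContinuousOn (fun q : ℝ × ℝ => if i = 0 then hWeight q.1 q.2 else totalWeight α q.1 q.2) strip := by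
        by_cases h : i = 0
        · simp only [h, ↓reduceIte]; exact continuousOn_hWeight
        · simp only [h, ↓reduceIte]; exact continuousOn_totalWeight α
      exact ((c1.mul c2).continuousOn.mul c3).aemeasurable measurableSet_strip
    -- pointwise domination by the Leibniz expansion
    have hpt : ∀ p ∈ strip, (Dθ^[i] (Dz^[j] (u * v)) p.1 p.2 * (if i = 0 then hWeight p.1 p.2 else totalWeight α p.1 p.2)) ^ 2 ≤
        (25 * 65536) * ∑ kl ∈ S, (G kl p.1 p.2) ^ 2 := by
      intro p hp
      set wt := (if i = 0 then hWeight p.1 p.2 else totalWeight α p.1 p.2) with hwt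
      rw [iterate_Dθ_Dz_mul_apply hu.smooth hv.smooth i j p.1 p.2, ← Finset.sum_product', Finset.sum_mul]
      have hcard : (S.card : ℝ) ≤ 25 := by
        rw [hS, Finset.card_product, Finset.card_range, Finset.card_range]
        have : (j + 1) * (i + 1) ≤ 25 := by nlinarith
        exact_mod_cast this
      have h1 := sq_sum_le_card_mul_sum_sq (s := S) (f := fun kl => ((j.choose kl.1 : ℝ) * (i.choose kl.2 : ℝ)) *
        ((Dθ^[kl.2] (Dz^[kl.1] u)) p.1 p.2 * (Dθ^[i - kl.2] (Dz^[j - kl.1] v)) p.1 p.2) * wt)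
      refine h1.trans ?_
      have hS0 : 0 ≤ ∑ kl ∈ S, (G kl p.1 p.2) ^ 2 := sum_nonneg fun _ _ => sq_nonneg _
      have h2 : ∀ kl ∈ S, (((j.choose kl.1 : ℝ) * (i.choose kl.2 : ℝ)) * ((Dθ^[kl.2] (Dz^[kl.1] u)) p.1 p.2 * (Dθ^[i - kl.2] (Dz^[j - kl.1] v)) p.1 p.2) * wt) ^ 2 ≤
          65536 * (G kl p.1 p.2) ^ 2 := by
        intro kl hkl
        rw [hS, Finset.mem_product, Finset.mem_range, Finset.mem_range] at hkl
        have hj : j ≤ 4 := by omega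
        have hi4 : i ≤ 4 := by omega
        have hcj : (j.choose kl.1 : ℝ) ≤ 16 := choose_le_sixteen hj
        have hci : (i.choose kl.2 : ℝ) ≤ 16 := choose_le_sixteen hi4
        have hcc : ((j.choose kl.1 : ℝ) * (i.choose kl.2 : ℝ)) ^ 2 ≤ 65536 := by
          have h0 : 0 ≤ (j.choose kl.1 : ℝ) * (i.choose kl.2 : ℝ) := by positivity
          have h16 : (j.choose kl.1 : ℝ) * (i.choose kl.2 : ℝ) ≤ 256 := by nlinarith [Nat.cast_nonneg (α := ℝ) (j.choose kl.1), Nat.cast_nonneg (α := ℝ) (i.choose kl.2)]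
          nlinarith
        have eG : G kl p.1 p.2 = ((Dθ^[kl.2] (Dz^[kl.1] u)) p.1 p.2 * (Dθ^[i - kl.2] (Dz^[j - kl.1] v)) p.1 p.2) * wt := rfl
        rw [eG, mul_pow, mul_pow]
        nlinarith [sq_nonneg ((Dθ^[kl.2] (Dz^[kl.1] u)) p.1 p.2 * (Dθ^[i - kl.2] (Dz^[j - kl.1] v)) p.1 p.2), sq_nonneg wt,
          mul_nonneg (sq_nonneg ((Dθ^[kl.2] (Dz^[kl.1] u)) p.1 p.2 * (Dθ^[i - kl.2] (Dz^[j - kl.1] v)) p.1 p.2)) (sq_nonneg wt)]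
      calc (S.card : ℝ) * ∑ kl ∈ S, (((j.choose kl.1 : ℝ) * (i.choose kl.2 : ℝ)) * ((Dθ^[kl.2] (Dz^[kl.1] u)) p.1 p.2 * (Dθ^[i - kl.2] (Dz^[j - kl.1] v)) p.1 p.2) * wt) ^ 2
          ≤ 25 * ∑ kl ∈ S, 65536 * (G kl p.1 p.2) ^ 2 := mul_le_mul hcard (sum_le_sum h2) (sum_nonneg fun _ _ => sq_nonneg _) (by norm_num)
        _ = (25 * 65536) * ∑ kl ∈ S, (G kl p.1 p.2) ^ 2 := by rw [← Finset.mul_sum]; ring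
    have hle := eL2Sq_le_of_sq_le_sum S (g := fun z θ => Dθ^[i] (Dz^[j] (u * v)) z θ * (if i = 0 then hWeight z θ else totalWeight α z θ))
      (C := 25 * 65536) (by norm_num) hGm hpt
    refine hle.trans ?_
    -- each `eL2Sq (G kl)` is a term of the bound
    have hGle : ∀ kl ∈ S, eL2Sq (G kl) ≤ c₀ * EE := by
      intro kl hkl
      rw [hS, Finset.mem_product, Finset.mem_range, Finset.mem_range] at hkl
      rw [eL2Sq_eq_lintegral_ofReal]
      have e : ∀ p ∈ strip, (G kl p.1 p.2) ^ 2 = radialWeight p.1 ^ 2 * (((Dθ^[kl.2] (Dz^[kl.1] u)) p.1 p.2) * ((Dθ^[i - kl.2] (Dz^[j - kl.1] v)) p.1 p.2)) ^ 2 *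
          Real.sin (2 * p.2) ^ (-c) := by
        intro p hp
        simp only [hG]
        by_cases h : i = 0
        · simp only [h, ↓reduceIte, hcdef]; rw [sq_mul_hWeight hp]; simp only [wEta]; ring
        · simp only [h, ↓reduceIte, hcdef]; rw [sq_mul_totalWeight α hp]; simp only [wGam]; ring
      rw [setLIntegral_congr_fun measurableSet_strip (fun p hp => by rw [e p hp])]
      refine lintegral_term_le hα hα10 hu hv (by omega) hc fun h => ?_
      rcases hgood kl.2 h with h' | h'
      · exact h'
      · omega
    calc ENNReal.ofReal (25 * 65536) * ∑ kl ∈ S, eL2Sq (G kl) ≤ ENNReal.ofReal (25 * 65536) * ∑ kl ∈ S, c₀ * EE := by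
          gcongr with kl hkl; exact hGle kl hkl
      _ = ENNReal.ofReal (25 * 65536) * ((S.card : ℝ≥0∞) * (c₀ * EE)) := by rw [sum_const, nsmul_eq_mul]
      _ ≤ ENNReal.ofReal (25 * 65536) * ((25 : ℝ≥0∞) * (c₀ * EE)) := by
          gcongr
          rw [hS, Finset.card_product, Finset.card_range, Finset.card_range]
          have : (j + 1) * (i + 1) ≤ 25 := by nlinarith
          exact_mod_cast this
      _ = ENNReal.ofReal (25 * 65536 * 25) * (c₀ * EE) := by
          rw [← mul_assoc, show (25 : ℝ≥0∞) = ENNReal.ofReal 25 by norm_num, ← ENNReal.ofReal_mul (by norm_num)]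
  have hB := eHkNormSq_le_of_forall_le (α := α) (k := 4) (f := u * v) (B := ENNReal.ofReal (25 * 65536 * 25) * (c₀ * EE))
    (fun j hj => by
      have := hterm 0 j (by omega) (Or.inl rfl)
      simp only [↓reduceIte] at this
      exact this)
    (fun i j hi hij => by
      have := hterm i j hij (Or.inr hi)
      have hi0 : i ≠ 0 := by omega
      simp only [hi0, ↓reduceIte] at this
      exact this)
  refine hB.trans (le_of_eq ?_)
  rw [show (((4 + 1) + (4 + 1) ^ 2 : ℕ) : ℝ≥0∞) = ENNReal.ofReal 30 by norm_num, hc₀, ← mul_assoc, ← mul_assoc,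
    ← ENNReal.ofReal_mul (by norm_num), ← ENNReal.ofReal_mul (by norm_num)]

end Elgindi

end Literature.Analysis.FluidPDE
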